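import Summits.QuantumFields.YangMills.Theorems.BalabanUVNodesClusters
import Summits.QuantumFields.YangMills.Theses.BalabanLadder

/-!
# BalabanUVNodes ∕ Clusters — LEAF: the `Iff.rfl` tether `uvD59_two_iff : UVD59 2 ↔ …Theses.BalabanLadder.UV` and the §6 ladder glue AT the leaf of
# record (`ladderUV_of_clusters`, `ladderUV_of_clusters₄`, `apex_of_ladderUV`, `uvApex_of_ladderUV`)

MAINTENANCE RESTRUCTURE (R201, director-ym LINE №92, 2026-08-27; no statement change, no proof change, no rename): these five declarations are MOVED
VERBATIM — same names, same namespace `YMDAG.UVSplit`, same docstrings — from `BalabanUVNodesClustersCore.lean` (:127–130, the tether) and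
`BalabanUVNodesClusters.lean` (§6, :117–147) into this leaf, which is now the ONLY module of the Track-A cluster chain importing the spine route file
`Summits.QuantumFields.YangMills.Theses.BalabanLadder`.  Before the split that import sat at `BalabanUVNodesClustersCore.lean:5` and put every Track-A
node module downstream of the Core (≈ 300 modules) into the rebuild cone of every `route-QuantumFields-BalabanLadder` edit, although only the tether
used it; after the split a spine edit (in particular the R85 restate of `UV`'s text, which makes `Iff.rfl` below stop elaborating) touches THIS module
and its importers only (the `BalabanLadderUVOtherGroups*` knit stack and `BalabanUVNodesN27AtRecordK4`, which import it for the tether by name).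

HONEST FRAMING.  Bookkeeping only: a definitional `Iff` and four compositions of tree theorems; 0 `sorry`, 0 `def`, standard axioms.  `UV` ∕ `UVD59 2`
is an OPEN ledger item (stmt-QuantumFields-19351), never asserted here; nothing of Bałaban's is discharged; not infinite volume, not OS on ℝ⁴, not a
mass gap, not Clay.
-/

namespace YMDAG.UVSplit

open Literature.MathematicalPhysics.QuantumFieldTheory.Balaban1983to89
open Literature.MathematicalPhysics.QuantumFieldTheory.Balaban1983to89.T4Continuum
open Summit.QuantumFields.BalabanUV.T4Continuum.Spine

/-! ## The tether (moved from `BalabanUVNodesClustersCore.lean` §2) -/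

/-- **THE TETHER (review p409153 (1))**: `UVD59 2` IS the spine route's rung-R4 leaf `Summit.QuantumFields.YangMills.Theses.BalabanLadder.UV`
(`route-QuantumFields-BalabanLadder`, item stmt-QuantumFields-19351; the leaf's body is this `def`'s at `N = 2` under an `open … in` prefix) —
definitional, `Iff.rfl`.  The D-0061 `closes_target` junction of the detail route «BalabanUVNodes». -/
theorem uvD59_two_iff : UVD59 2 ↔ Summit.QuantumFields.YangMills.Theses.BalabanLadder.UV := Iff.rfl

/-! ## §6 AT THE LEAF OF RECORD `Summit.QuantumFields.YangMills.Theses.BalabanLadder.UV` (= `UVD59 2`, `uvD59_two_iff`) — the joins BY NAME, and the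
leaf in apex currency (the first step under `BalabanLadder.UVSeam`'s hypothesis `UV → …`) -/

section LadderGlue

variable (Rec : RecordPred 2) (Inputs : InputsPred 2)

/-- **THE `closes` SHAPE OF «BalabanUVNodes» AT THE LEAF (kernel)**: K1 «KnitIR» → K2 «FlowBounds» → K3 «RenormalisationBeta» → K4 «SpineRates» →
K5 «SpineMatching» → `BalabanLadder.UV`, at SU(2), for ANY record predicate `Rec` and inputs predicate `Inputs`. -/
theorem ladderUV_of_clusters (h1 : KnitIR Rec) (h2 : FlowBounds Rec) (h3 : RenormalisationBeta Rec) (h4 : SpineRates Rec Inputs)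
    (h5 : SpineMatching Rec Inputs) : Summit.QuantumFields.YangMills.Theses.BalabanLadder.UV :=
  uvD59_two_iff.mp (uvD59_of_clusters Rec Inputs h1 h2 h3 h4 h5)

/-- Merged-spine form: K1 → K2 → K3 → «Spine» → `BalabanLadder.UV`. -/
theorem ladderUV_of_clusters₄ (h1 : KnitIR Rec) (h2 : FlowBounds Rec) (h3 : RenormalisationBeta Rec) (hS : Spine Rec) :
    Summit.QuantumFields.YangMills.Theses.BalabanLadder.UV :=
  uvD59_two_iff.mp (uvD59_of_clusters₄ Rec h1 h2 h3 hS)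

end LadderGlue

/-- From the leaf to apex currency on every family: a Stage-0 datum of record with END and the continuum limit of the tuned loop expectations in
both readings. -/
theorem apex_of_ladderUV (h : Summit.QuantumFields.YangMills.Theses.BalabanLadder.UV) (F : T4Family) :
    ∃ D : Datum F 2, Node00.IsDatumOfRecord₀ F 2 D ∧ DagBinding.EndpointExistence D.C.toB12 ∧
      T4ContinuumYM4Torus.ContinuumYM4Torus D ∧ T4ContinuumYM4Torus.ContinuumYM4TorusE D :=
  apex_of_uvD59 (uvD59_two_iff.mpr h) F

/-- The leaf gives the closed apex ∃-form `UVApex 2`. -/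
theorem uvApex_of_ladderUV (h : Summit.QuantumFields.YangMills.Theses.BalabanLadder.UV) (F : T4Family) : UVApex 2 :=
  uvApex_of_uvD59 (uvD59_two_iff.mpr h) F

end YMDAG.UVSplit
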